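import Literature.MathematicalPhysics.QuantumFieldTheory.Balaban1983to89.BlockAveragingEMLAnalyticMean
import Literature.MathematicalPhysics.QuantumFieldTheory.Balaban1983to89.BlockAveragingEMLLinearised
import Literature.MathematicalPhysics.QuantumFieldTheory.Balaban1983to89.BlockAveragingPlaquetteBoundLocal
import Literature.MathematicalPhysics.QuantumFieldTheory.Balaban1983to89.T4ReflectionConeSharp
import Literature.Analysis.Complex.RungeUnits
import HarnessLib

/-!
# One Bałaban averaging step is link-Lipschitz on locally small fields (crux stmt-QuantumFields-19936, line `poincare_lipschitz`,
# stub `stub_levelOneLipschitz` — the deterministic one-step estimate, generic level)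

For the (0.4)-shaped block averaging `Ū = avgFun expMeanLogSU U` of [Balaban1987RG1] on `SU(N)` and a coarse plaquette `a` of
`T^{(j+1)}`: if two fine configurations `U, U'` have all plaquettes based in the blocks around `a` within `θ` of `1`, with
`(((d+2)L)²/4)·θ ≤ δ_N/2` (so every (0.4) loop variable at the four bonds of `∂a` lies in HALF the guard of the printed small-loop
operation, by the tree's local Stokes bound `BlockAveragingPlaquetteBoundLocal.dist1_loopHol_le_local`), and `‖U_b − U'_b‖ ≤ ρ` on every
fine bond with both ends in the two blocks of each bond of `∂a`, then
`|dist1 (Ū(∂a)) − dist1 (Ū'(∂a))| ≤ 4·(24(d+2)L + L)·ρ` (`abs_dist1_plaqHol_avgFun_sub_le`).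

Ingredients (all elementary): the printed operation `eml = exp ∘ mean ∘ log` is `24`-Lipschitz in the sup norm on the sixth-guard
(`norm_eml_sub_eml_le`, from the tree's analytic-mean bounds `BlockAveragingEMLAnalyticMean.norm_eml_add_sub_eml_le` and
`IsAnalyticMean.norm_sub_one_le`); ordered products of unitaries are `1`-Lipschitz per factor (`Literature.Analysis.Complex.norm_list_prod_sub_list_prod_le`),
whence holonomies (`norm_coe_holAt_sub_le`), the (0.4) loop variables, the correction factor (`norm_coe_corr_sub_le`), the straight
transporter (`norm_coe_axialAvg_sub_le`), the averaged bond variable (`norm_coe_avgFun_sub_le`) and the coarse plaquette variable.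

Width seat ym-ust-19936-w5 g9 (cell ym3-torus), `--supports stmt-QuantumFields-19936`.  HONEST: a helper toward the j = 1 rung of the
route crux `BlockLipschitzL`; no crux, rung (R3 = YM₃ on T³, not d = 4, not Clay) or summit statement is proved here.
-/

noncomputable section

open scoped BigOperators Matrix.Norms.L2Operator

namespace Summit.QuantumFields.YangMills.Theorems.PoincareLipschitzOneStep

open Literature.MathematicalPhysics.QuantumFieldTheory.Balaban1983to89
open T4Continuum BlockAveraging AveragingRT ExpMeanLog BlockAveragingEMLAnalyticMean

/-! ## §1 The printed small-loop operation is Lipschitz on the sixth-guard -/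

section Eml

variable {ι : Type*} [Fintype ι] {𝔸 : Type*} [NormedRing 𝔸] [NormedAlgebra ℂ 𝔸] [CompleteSpace 𝔸]

/-- **`eml` is `24`-Lipschitz in the sup norm on `{‖W − 1‖ ≤ 1/6}`**: small increments by the tree's `L_M = 12` bound
(`norm_eml_add_sub_eml_le`), large increments (`> 1/24`) by `‖eml W − 1‖ ≤ 1/2` on the polydisc of radius `1/3`. [folklore] -/
theorem norm_eml_sub_eml_le {W W' : ι → 𝔸} (hW : ‖W - 1‖ ≤ 1 / 6) (hW' : ‖W' - 1‖ ≤ 1 / 6) :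
    ‖eml W - eml W'‖ ≤ 24 * ‖W - W'‖ := by
  by_cases h : ‖W' - W‖ ≤ 1 / 24
  · have h1 := norm_eml_add_sub_eml_le (ι := ι) (𝔸 := 𝔸) (U := W) (V := W' - W) hW h
    rw [add_sub_cancel, norm_sub_rev] at h1
    rw [norm_sub_rev W W']
    linarith [norm_nonneg (W' - W)]
  · push Not at h
    have hb : ∀ {V : ι → 𝔸}, ‖V - 1‖ ≤ 1 / 6 → V ∈ Metric.ball (1 : ι → 𝔸) (1 / 3) := fun hV => by
      rw [Metric.mem_ball, dist_eq_norm]; linarith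
    have e1 : ‖eml W - 1‖ ≤ 1 / 2 := (isAnalyticMean_eml (ι := ι) (𝔸 := 𝔸)).norm_sub_one_le W (hb hW)
    have e2 : ‖eml W' - 1‖ ≤ 1 / 2 := (isAnalyticMean_eml (ι := ι) (𝔸 := 𝔸)).norm_sub_one_le W' (hb hW')
    have e3 : ‖eml W - eml W'‖ ≤ 1 := by
      calc ‖eml W - eml W'‖ = ‖(eml W - 1) - (eml W' - 1)‖ := by rw [sub_sub_sub_cancel_right]
        _ ≤ ‖eml W - 1‖ + ‖eml W' - 1‖ := norm_sub_le _ _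
        _ ≤ 1 := by linarith
    rw [norm_sub_rev] at h
    linarith

end Eml

/-! ## §2 Holonomies, loop variables, correction factors and transporters are link-Lipschitz -/

section Hol

variable {n : Type*} [Fintype n] [DecidableEq n] [Nonempty n] {P : Params} {j : ℕ}

/-- The step factors have norm `1`. [folklore] -/
theorem norm_stepFactor_le (U : GaugeField P j (Matrix.specialUnitaryGroup n ℂ)) (s : LStep P j) :
    ‖BlockAveragingEMLLinearised.stepFactor U s‖ ≤ 1 := by
  have h1 : ‖((U s.bond : Matrix.specialUnitaryGroup n ℂ) : Matrix n n ℂ)‖ = 1 :=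
    CStarRing.norm_of_mem_unitary (Matrix.mem_specialUnitaryGroup_iff.1 (U s.bond).2).1
  unfold BlockAveragingEMLLinearised.stepFactor
  split_ifs
  · exact h1.le
  · rw [norm_star]; exact h1.le

omit [Nonempty n] in
/-- The step factors are `1`-Lipschitz in the bond variable. [folklore] -/
theorem norm_stepFactor_sub_le (U U' : GaugeField P j (Matrix.specialUnitaryGroup n ℂ)) (s : LStep P j) :
    ‖BlockAveragingEMLLinearised.stepFactor U s - BlockAveragingEMLLinearised.stepFactor U' s‖ ≤
      ‖((U s.bond : Matrix.specialUnitaryGroup n ℂ) : Matrix n n ℂ) - (U' s.bond : Matrix n n ℂ)‖ := by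
  unfold BlockAveragingEMLLinearised.stepFactor
  split_ifs
  · exact le_rfl
  · rw [← star_sub, norm_star]

/-- **HOLONOMIES ARE LINK-LIPSCHITZ**: if `‖U_b − U'_b‖ ≤ ρ` on every bond of the walk `γ`, then `‖U(γ) − U'(γ)‖ ≤ |γ|·ρ`
(ordered products of unitaries). [folklore] -/
theorem norm_coe_holAt_sub_le (U U' : GaugeField P j (Matrix.specialUnitaryGroup n ℂ)) {ρ : ℝ} (hρ : 0 ≤ ρ)
    (γ : List (LStep P j))
    (h : ∀ s ∈ γ, ‖((U s.bond : Matrix.specialUnitaryGroup n ℂ) : Matrix n n ℂ) - (U' s.bond : Matrix n n ℂ)‖ ≤ ρ) :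
    ‖((holAt U γ : Matrix.specialUnitaryGroup n ℂ) : Matrix n n ℂ) -
        ((holAt U' γ : Matrix.specialUnitaryGroup n ℂ) : Matrix n n ℂ)‖ ≤ γ.length * ρ := by
  rw [BlockAveragingEMLLinearised.coe_holAt_eq_prod_stepFactor, BlockAveragingEMLLinearised.coe_holAt_eq_prod_stepFactor]
  have key := Literature.Analysis.Complex.norm_list_prod_sub_list_prod_le γ
    (BlockAveragingEMLLinearised.stepFactor U) (BlockAveragingEMLLinearised.stepFactor U') (B := 1) le_rfl hρ
    (fun s _ => norm_stepFactor_le U s) (fun s _ => norm_stepFactor_le U' s)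
    (fun s hs => (norm_stepFactor_sub_le U U' s).trans (h s hs))
  simpa using key

/-- `‖(g h) − (g' h')‖ ≤ ‖g − g'‖ + ‖h − h'‖` in `SU(N)` (products of unitaries are `1`-Lipschitz in each factor). [folklore] -/
theorem norm_coe_mul_sub_le (g g' h h' : Matrix.specialUnitaryGroup n ℂ) :
    ‖((g * h : Matrix.specialUnitaryGroup n ℂ) : Matrix n n ℂ) - ((g' * h' : Matrix.specialUnitaryGroup n ℂ) : Matrix n n ℂ)‖ ≤
      ‖(g : Matrix n n ℂ) - (g' : Matrix n n ℂ)‖ + ‖(h : Matrix n n ℂ) - (h' : Matrix n n ℂ)‖ := by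
  rw [Submonoid.coe_mul, Submonoid.coe_mul]
  have e : (g : Matrix n n ℂ) * (h : Matrix n n ℂ) - (g' : Matrix n n ℂ) * (h' : Matrix n n ℂ) =
      ((g : Matrix n n ℂ) - (g' : Matrix n n ℂ)) * (h : Matrix n n ℂ) + (g' : Matrix n n ℂ) * ((h : Matrix n n ℂ) - (h' : Matrix n n ℂ)) := by
    noncomm_ring
  rw [e]
  refine (norm_add_le _ _).trans (add_le_add ?_ ?_)
  · calc _ ≤ ‖(g : Matrix n n ℂ) - (g' : Matrix n n ℂ)‖ * ‖(h : Matrix n n ℂ)‖ := norm_mul_le _ _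
      _ = _ := by rw [CStarRing.norm_of_mem_unitary (Matrix.mem_specialUnitaryGroup_iff.1 h.2).1, mul_one]
  · calc _ ≤ ‖(g' : Matrix n n ℂ)‖ * ‖(h : Matrix n n ℂ) - (h' : Matrix n n ℂ)‖ := norm_mul_le _ _
      _ = _ := by rw [CStarRing.norm_of_mem_unitary (Matrix.mem_specialUnitaryGroup_iff.1 g'.2).1, one_mul]

/-- `|dist1 g − dist1 g'| ≤ ‖g − g'‖`. [folklore] -/
theorem abs_dist1_sub_dist1_le (g g' : Matrix.specialUnitaryGroup n ℂ) :
    |dist1 g - dist1 g'| ≤ ‖(g : Matrix n n ℂ) - (g' : Matrix n n ℂ)‖ := by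
  rw [FederbushMean.dist1_SU_eq, FederbushMean.dist1_SU_eq]
  have h := abs_norm_sub_norm_le ((g : Matrix n n ℂ) - 1) ((g' : Matrix n n ℂ) - 1)
  rwa [sub_sub_sub_cancel_right] at h

/-- **THE (0.4) LOOP VARIABLES ARE LINK-LIPSCHITZ** (standing range): if `‖U_b − U'_b‖ ≤ ρ` on every fine bond with both ends in
`B(c₋) ∪ B(c₊)`, then every loop variable at `c` moves by at most `(d+2)L·ρ` (every bond of the loop `Γ ∪ [x,x′] ∪ (−Γ′) ∪ (−c)` has
both ends in the two blocks, `blockOf_src_of_mem_walk` ∕ `blockOf_tgt_of_mem_walk`; its length is `≤ (d+2)L`). [cite: Balaban1987RG1, (0.4) p.253] -/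
theorem norm_coe_loopHol_sub_le (hj : j + 1 ≤ P.m + P.K) (U U' : GaugeField P j (Matrix.specialUnitaryGroup n ℂ))
    (c : PBond P (j + 1)) {ρ : ℝ} (hρ : 0 ≤ ρ)
    (hUU' : ∀ b : PBond P j, (blockOf b.src = c.src ∨ blockOf b.src = c.tgt) →
      (blockOf b.tgt = c.src ∨ blockOf b.tgt = c.tgt) →
        ‖((U b : Matrix.specialUnitaryGroup n ℂ) : Matrix n n ℂ) - (U' b : Matrix n n ℂ)‖ ≤ ρ)
    (i : Idx P) :
    ‖((loopHol U c i : Matrix.specialUnitaryGroup n ℂ) : Matrix n n ℂ) -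
        ((loopHol U' c i : Matrix.specialUnitaryGroup n ℂ) : Matrix n n ℂ)‖ ≤ (((P.d + 2) * P.L : ℕ) : ℝ) * ρ := by
  unfold loopHol
  have h := norm_coe_holAt_sub_le U U' hρ (walk (emb c.src) (loopWord P.L c.dir (off i.1) i.2.1 i.2.2))
    (fun s hs => hUU' s.bond (blockOf_src_of_mem_walk hj c i s hs) (T4ReflectionConeSharp.blockOf_tgt_of_mem_walk hj c i s hs))
  refine h.trans (mul_le_mul_of_nonneg_right ?_ hρ)
  exact_mod_cast (BlockAveragingEMLLinearised.length_walk _ _).le.trans (LatticeWordStokes.length_loopWord_le c i)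

/-- **THE CORRECTION FACTOR OF (0.4) IS LINK-LIPSCHITZ ON THE HALF-GUARD** (`SU(N)`, the printed `exp[mean log]`): if every loop
variable at `c` of `U` and of `U'` is within `δ_N/2` of `1` and `‖U_b − U'_b‖ ≤ ρ` on the bonds of the two blocks of `c`, then
`‖corr U c − corr U' c‖ ≤ 24·(d+2)L·ρ`. [cite: Balaban1987RG1, (0.4) p.253] -/
theorem norm_coe_corr_sub_le (hj : j + 1 ≤ P.m + P.K) (U U' : GaugeField P j (Matrix.specialUnitaryGroup n ℂ))
    (c : PBond P (j + 1)) (h6 : ∀ i, dist1 (loopHol U c i) ≤ deltaSU n / 2) (h6' : ∀ i, dist1 (loopHol U' c i) ≤ deltaSU n / 2)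
    {ρ : ℝ} (hρ : 0 ≤ ρ)
    (hUU' : ∀ b : PBond P j, (blockOf b.src = c.src ∨ blockOf b.src = c.tgt) →
      (blockOf b.tgt = c.src ∨ blockOf b.tgt = c.tgt) →
        ‖((U b : Matrix.specialUnitaryGroup n ℂ) : Matrix n n ℂ) - (U' b : Matrix n n ℂ)‖ ≤ ρ) :
    ‖((corr (expMeanLogSU (n := n)) U c : Matrix.specialUnitaryGroup n ℂ) : Matrix n n ℂ) -
        ((corr (expMeanLogSU (n := n)) U' c : Matrix.specialUnitaryGroup n ℂ) : Matrix n n ℂ)‖ ≤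
      24 * ((((P.d + 2) * P.L : ℕ) : ℝ) * ρ) := by
  have hδ3 : deltaSU n ≤ 1 / 3 := min_le_left _ _
  have hδpos : 0 < deltaSU n := deltaSU_pos
  have hS : Small (expMeanLogSU (n := n)) U c := fun i => (h6 i).trans_lt (by
    show deltaSU n / 2 < (expMeanLogSU (n := n)).δ
    rw [expMeanLogSU_δ]; exact half_lt_self hδpos)
  have hS' : Small (expMeanLogSU (n := n)) U' c := fun i => (h6' i).trans_lt (by
    show deltaSU n / 2 < (expMeanLogSU (n := n)).δ
    rw [expMeanLogSU_δ]; exact half_lt_self hδpos)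
  unfold corr
  rw [if_pos hS, if_pos hS']
  unfold LoopAverage.avg
  set e := LoopAverage.enum (Idx P) with he
  have hW : ∀ k, dist1 ((loopHol U c ∘ e.symm) k) < deltaSU n := fun k => hS _
  have hW' : ∀ k, dist1 ((loopHol U' c ∘ e.symm) k) < deltaSU n := fun k => hS' _
  rw [show (expMeanLogSU (n := n)).E (loopHol U c ∘ e.symm) = (expMeanLogSU (n := n)).E (loopHol U c ∘ e.symm) from rfl,
    coe_expMeanLogSU_E_eq_eml _ hW, coe_expMeanLogSU_E_eq_eml _ hW']
  refine (norm_eml_sub_eml_le ?_ ?_).trans ?_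
  · refine (pi_norm_le_iff_of_nonneg (by norm_num)).mpr fun k => ?_
    show ‖((loopHol U c (e.symm k) : Matrix.specialUnitaryGroup n ℂ) : Matrix n n ℂ) - 1‖ ≤ 1 / 6
    rw [← FederbushMean.dist1_SU_eq]; exact (h6 _).trans (by linarith)
  · refine (pi_norm_le_iff_of_nonneg (by norm_num)).mpr fun k => ?_
    show ‖((loopHol U' c (e.symm k) : Matrix.specialUnitaryGroup n ℂ) : Matrix n n ℂ) - 1‖ ≤ 1 / 6
    rw [← FederbushMean.dist1_SU_eq]; exact (h6' _).trans (by linarith)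
  · refine mul_le_mul_of_nonneg_left ?_ (by norm_num)
    refine (pi_norm_le_iff_of_nonneg (mul_nonneg (Nat.cast_nonneg _) hρ)).mpr fun k => ?_
    exact norm_coe_loopHol_sub_le hj U U' c hρ hUU' (e.symm k)

/-- **THE STRAIGHT TRANSPORTER IS LINK-LIPSCHITZ**: `‖U(b₀⋯b_{t−1}) − U'(b₀⋯b_{t−1})‖ ≤ t·ρ` along the line of `c` (`t ≤ L`; each line
bond has both ends in `B(c₋) ∪ B(c₊)`). [cite: Balaban1984PropagatorsI, (1.7) p.18] -/
theorem norm_coe_pathProd_sub_le (hj : j + 1 ≤ P.m + P.K) (U U' : GaugeField P j (Matrix.specialUnitaryGroup n ℂ))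
    (c : PBond P (j + 1)) {ρ : ℝ} (hρ : 0 ≤ ρ)
    (hUU' : ∀ b : PBond P j, (blockOf b.src = c.src ∨ blockOf b.src = c.tgt) →
      (blockOf b.tgt = c.src ∨ blockOf b.tgt = c.tgt) →
        ‖((U b : Matrix.specialUnitaryGroup n ℂ) : Matrix n n ℂ) - (U' b : Matrix n n ℂ)‖ ≤ ρ) :
    ∀ t : ℕ, t ≤ P.L → ‖((pathProd U c t : Matrix.specialUnitaryGroup n ℂ) : Matrix n n ℂ) -
        ((pathProd U' c t : Matrix.specialUnitaryGroup n ℂ) : Matrix n n ℂ)‖ ≤ (t : ℝ) * ρ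
  | 0, _ => by simp [pathProd]
  | t + 1, ht => by
    have ih := norm_coe_pathProd_sub_le hj U U' c hρ hUU' t (by omega)
    have hb := hUU' (line c t) (blockOf_lineSite hj c (by omega)) (T4ReflectionConeSharp.blockOf_tgt_line hj c (by omega))
    simp only [pathProd]
    refine (norm_coe_mul_sub_le _ _ _ _).trans ?_
    push_cast
    linarith

/-- `‖U(c) − U'(c)‖ ≤ L·ρ` for the straight transporter `axialAvg`. [cite: Balaban1984PropagatorsI, (1.7) p.18] -/
theorem norm_coe_axialAvg_sub_le (hj : j + 1 ≤ P.m + P.K) (U U' : GaugeField P j (Matrix.specialUnitaryGroup n ℂ))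
    (c : PBond P (j + 1)) {ρ : ℝ} (hρ : 0 ≤ ρ)
    (hUU' : ∀ b : PBond P j, (blockOf b.src = c.src ∨ blockOf b.src = c.tgt) →
      (blockOf b.tgt = c.src ∨ blockOf b.tgt = c.tgt) →
        ‖((U b : Matrix.specialUnitaryGroup n ℂ) : Matrix n n ℂ) - (U' b : Matrix n n ℂ)‖ ≤ ρ) :
    ‖((axialAvg U c : Matrix.specialUnitaryGroup n ℂ) : Matrix n n ℂ) -
        ((axialAvg U' c : Matrix.specialUnitaryGroup n ℂ) : Matrix n n ℂ)‖ ≤ (P.L : ℝ) * ρ :=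
  norm_coe_pathProd_sub_le hj U U' c hρ hUU' P.L le_rfl

/-- **ONE AVERAGED BOND VARIABLE IS LINK-LIPSCHITZ** on the half-guard: `‖Ū(c) − Ū'(c)‖ ≤ (24(d+2)L + L)·ρ`.
[cite: Balaban1987RG1, (0.4) p.253] -/
theorem norm_coe_avgFun_sub_le (hj : j + 1 ≤ P.m + P.K) (U U' : GaugeField P j (Matrix.specialUnitaryGroup n ℂ))
    (c : PBond P (j + 1)) (h6 : ∀ i, dist1 (loopHol U c i) ≤ deltaSU n / 2) (h6' : ∀ i, dist1 (loopHol U' c i) ≤ deltaSU n / 2)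
    {ρ : ℝ} (hρ : 0 ≤ ρ)
    (hUU' : ∀ b : PBond P j, (blockOf b.src = c.src ∨ blockOf b.src = c.tgt) →
      (blockOf b.tgt = c.src ∨ blockOf b.tgt = c.tgt) →
        ‖((U b : Matrix.specialUnitaryGroup n ℂ) : Matrix n n ℂ) - (U' b : Matrix n n ℂ)‖ ≤ ρ) :
    ‖((avgFun (expMeanLogSU (n := n)) U c : Matrix.specialUnitaryGroup n ℂ) : Matrix n n ℂ) -
        ((avgFun (expMeanLogSU (n := n)) U' c : Matrix.specialUnitaryGroup n ℂ) : Matrix n n ℂ)‖ ≤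
      (24 * (((P.d + 2) * P.L : ℕ) : ℝ) + P.L) * ρ := by
  unfold avgFun
  refine (norm_coe_mul_sub_le _ _ _ _).trans ?_
  have h1 := norm_coe_corr_sub_le hj U U' c h6 h6' hρ hUU'
  have h2 := norm_coe_axialAvg_sub_le hj U U' c hρ hUU'
  linarith

end Hol

/-! ## §3 The coarse plaquette variable, and the one-step estimate -/

section Plaq

variable {n : Type*} [Fintype n] [DecidableEq n] [Nonempty n] {P : Params} {j : ℕ}

/-- `‖g₁g₂g₃⁻¹g₄⁻¹ − g₁'g₂'g₃'⁻¹g₄'⁻¹‖ ≤ Σ_i ‖g_i − g_i'‖` in `SU(N)` (the shape of a plaquette variable). [folklore] -/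
theorem norm_coe_plaqWord_sub_le (g₁ g₂ g₃ g₄ g₁' g₂' g₃' g₄' : Matrix.specialUnitaryGroup n ℂ) :
    ‖((g₁ * g₂ * g₃⁻¹ * g₄⁻¹ : Matrix.specialUnitaryGroup n ℂ) : Matrix n n ℂ) -
        ((g₁' * g₂' * g₃'⁻¹ * g₄'⁻¹ : Matrix.specialUnitaryGroup n ℂ) : Matrix n n ℂ)‖ ≤
      ‖(g₁ : Matrix n n ℂ) - (g₁' : Matrix n n ℂ)‖ + ‖(g₂ : Matrix n n ℂ) - (g₂' : Matrix n n ℂ)‖ +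
        ‖(g₃ : Matrix n n ℂ) - (g₃' : Matrix n n ℂ)‖ + ‖(g₄ : Matrix n n ℂ) - (g₄' : Matrix n n ℂ)‖ := by
  have h4 := norm_coe_mul_sub_le (g₁ * g₂ * g₃⁻¹) (g₁' * g₂' * g₃'⁻¹) g₄⁻¹ g₄'⁻¹
  have h3 := norm_coe_mul_sub_le (g₁ * g₂) (g₁' * g₂') g₃⁻¹ g₃'⁻¹
  have h2 := norm_coe_mul_sub_le g₁ g₁' g₂ g₂'
  -- `‖g⁻¹ − g'⁻¹‖ = ‖g − g'‖` (`g⁻¹ = g*`, the operator norm is `*`-invariant; tree `AvgCurvGrad.norm_coe_inv_sub_inv`)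
  have hinv : ∀ g g' : Matrix.specialUnitaryGroup n ℂ,
      ‖((g⁻¹ : Matrix.specialUnitaryGroup n ℂ) : Matrix n n ℂ) - ((g'⁻¹ : Matrix.specialUnitaryGroup n ℂ) : Matrix n n ℂ)‖ =
        ‖(g : Matrix n n ℂ) - (g' : Matrix n n ℂ)‖ := fun g g' => by
    show ‖star (g : Matrix n n ℂ) - star (g' : Matrix n n ℂ)‖ = _
    rw [← star_sub, norm_star]
  rw [hinv] at h4 h3
  linarith

/-- **PLAQUETTE VARIABLES ARE LINK-LIPSCHITZ**: `‖V(∂p) − V'(∂p)‖ ≤ 4τ` when the four bond variables of `∂p` differ by at most `τ`.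
[cite: Balaban1985Averaging, (9) p.19] -/
theorem norm_coe_plaqHol_sub_le (V V' : GaugeField P j (Matrix.specialUnitaryGroup n ℂ)) (p : Plaq P j) {τ : ℝ}
    (h1 : ‖((V ⟨p.src, p.μ⟩ : Matrix.specialUnitaryGroup n ℂ) : Matrix n n ℂ) - (V' ⟨p.src, p.μ⟩ : Matrix n n ℂ)‖ ≤ τ)
    (h2 : ‖((V ⟨p.src.shift p.μ, p.ν⟩ : Matrix.specialUnitaryGroup n ℂ) : Matrix n n ℂ) - (V' ⟨p.src.shift p.μ, p.ν⟩ : Matrix n n ℂ)‖ ≤ τ)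
    (h3 : ‖((V ⟨p.src.shift p.ν, p.μ⟩ : Matrix.specialUnitaryGroup n ℂ) : Matrix n n ℂ) - (V' ⟨p.src.shift p.ν, p.μ⟩ : Matrix n n ℂ)‖ ≤ τ)
    (h4 : ‖((V ⟨p.src, p.ν⟩ : Matrix.specialUnitaryGroup n ℂ) : Matrix n n ℂ) - (V' ⟨p.src, p.ν⟩ : Matrix n n ℂ)‖ ≤ τ) :
    ‖((GaugeField.plaqHol V p : Matrix.specialUnitaryGroup n ℂ) : Matrix n n ℂ) -
        ((GaugeField.plaqHol V' p : Matrix.specialUnitaryGroup n ℂ) : Matrix n n ℂ)‖ ≤ 4 * τ := by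
  have h := norm_coe_plaqWord_sub_le (V ⟨p.src, p.μ⟩) (V ⟨p.src.shift p.μ, p.ν⟩) (V ⟨p.src.shift p.ν, p.μ⟩) (V ⟨p.src, p.ν⟩)
    (V' ⟨p.src, p.μ⟩) (V' ⟨p.src.shift p.μ, p.ν⟩) (V' ⟨p.src.shift p.ν, p.μ⟩) (V' ⟨p.src, p.ν⟩)
  have e : ∀ W : GaugeField P j (Matrix.specialUnitaryGroup n ℂ), GaugeField.plaqHol W p =
      W ⟨p.src, p.μ⟩ * W ⟨p.src.shift p.μ, p.ν⟩ * (W ⟨p.src.shift p.ν, p.μ⟩)⁻¹ * (W ⟨p.src, p.ν⟩)⁻¹ := fun W => rfl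
  rw [e V, e V']
  linarith

/-- **ONE BAŁABAN AVERAGING STEP IS LINK-LIPSCHITZ ON LOCALLY SMALL FIELDS** (standing range, `SU(N)`, the printed `exp[mean log]`):
if the fine plaquettes based in the blocks `B(c₋ − e_{dir c}) ∪ B(c₋) ∪ B(c₊)` of each of the four bonds `c` of `∂a` are within `θ`
of `1` for both `U` and `U'`, with `(((d+2)L)²/4)·θ ≤ δ_N/2`, and `‖U_b − U'_b‖ ≤ ρ` on every fine bond with both ends in the two blocks
of a bond of `∂a`, then `|dist1 (Ū(∂a)) − dist1 (Ū'(∂a))| ≤ 4·(24(d+2)L + L)·ρ`. [cite: Balaban1987RG1, (0.4) p.253] -/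
theorem abs_dist1_plaqHol_avgFun_sub_le (hj : j + 1 ≤ P.m + P.K) (U U' : GaugeField P j (Matrix.specialUnitaryGroup n ℂ))
    (a : Plaq P (j + 1)) {θ : ℝ} (hθ : 0 ≤ θ) (hθδ : ((((P.d + 2) * P.L : ℕ) : ℝ) ^ 2 / 4) * θ ≤ deltaSU n / 2)
    (hU : ∀ c : PBond P (j + 1), (c = ⟨a.src, a.μ⟩ ∨ c = ⟨a.src.shift a.μ, a.ν⟩ ∨ c = ⟨a.src.shift a.ν, a.μ⟩ ∨ c = ⟨a.src, a.ν⟩) →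
      ∀ q : Plaq P j, (blockOf q.src = c.src.unshift c.dir ∨ blockOf q.src = c.src ∨ blockOf q.src = c.tgt) →
        dist1 (GaugeField.plaqHol U q) < θ)
    (hU' : ∀ c : PBond P (j + 1), (c = ⟨a.src, a.μ⟩ ∨ c = ⟨a.src.shift a.μ, a.ν⟩ ∨ c = ⟨a.src.shift a.ν, a.μ⟩ ∨ c = ⟨a.src, a.ν⟩) →
      ∀ q : Plaq P j, (blockOf q.src = c.src.unshift c.dir ∨ blockOf q.src = c.src ∨ blockOf q.src = c.tgt) →
        dist1 (GaugeField.plaqHol U' q) < θ)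
    {ρ : ℝ} (hρ : 0 ≤ ρ)
    (hUU' : ∀ c : PBond P (j + 1), (c = ⟨a.src, a.μ⟩ ∨ c = ⟨a.src.shift a.μ, a.ν⟩ ∨ c = ⟨a.src.shift a.ν, a.μ⟩ ∨ c = ⟨a.src, a.ν⟩) →
      ∀ b : PBond P j, (blockOf b.src = c.src ∨ blockOf b.src = c.tgt) → (blockOf b.tgt = c.src ∨ blockOf b.tgt = c.tgt) →
        ‖((U b : Matrix.specialUnitaryGroup n ℂ) : Matrix n n ℂ) - (U' b : Matrix n n ℂ)‖ ≤ ρ) :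
    |dist1 (GaugeField.plaqHol (avgFun (expMeanLogSU (n := n)) U) a) -
        dist1 (GaugeField.plaqHol (avgFun (expMeanLogSU (n := n)) U') a)| ≤
      4 * ((24 * (((P.d + 2) * P.L : ℕ) : ℝ) + P.L) * ρ) := by
  -- every loop variable at a bond of `∂a` is within `δ_N/2` of `1`
  have h6 : ∀ c : PBond P (j + 1), (c = ⟨a.src, a.μ⟩ ∨ c = ⟨a.src.shift a.μ, a.ν⟩ ∨ c = ⟨a.src.shift a.ν, a.μ⟩ ∨ c = ⟨a.src, a.ν⟩) →
      (∀ i, dist1 (loopHol U c i) ≤ deltaSU n / 2) ∧ (∀ i, dist1 (loopHol U' c i) ≤ deltaSU n / 2) := fun c hc =>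
    ⟨fun i => (BlockAveragingPlaquetteBoundLocal.dist1_loopHol_le_local hθ hj c (hU c hc) i).trans hθδ,
     fun i => (BlockAveragingPlaquetteBoundLocal.dist1_loopHol_le_local hθ hj c (hU' c hc) i).trans hθδ⟩
  have hb : ∀ c : PBond P (j + 1), (c = ⟨a.src, a.μ⟩ ∨ c = ⟨a.src.shift a.μ, a.ν⟩ ∨ c = ⟨a.src.shift a.ν, a.μ⟩ ∨ c = ⟨a.src, a.ν⟩) →
      ‖((avgFun (expMeanLogSU (n := n)) U c : Matrix.specialUnitaryGroup n ℂ) : Matrix n n ℂ) -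
        ((avgFun (expMeanLogSU (n := n)) U' c : Matrix.specialUnitaryGroup n ℂ) : Matrix n n ℂ)‖ ≤
      (24 * (((P.d + 2) * P.L : ℕ) : ℝ) + P.L) * ρ := fun c hc =>
    norm_coe_avgFun_sub_le hj U U' c (h6 c hc).1 (h6 c hc).2 hρ (hUU' c hc)
  refine (abs_dist1_sub_dist1_le _ _).trans ?_
  exact norm_coe_plaqHol_sub_le _ _ a (hb _ (Or.inl rfl)) (hb _ (Or.inr (Or.inl rfl)))
    (hb _ (Or.inr (Or.inr (Or.inl rfl)))) (hb _ (Or.inr (Or.inr (Or.inr rfl))))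

end Plaq

end Summit.QuantumFields.YangMills.Theorems.PoincareLipschitzOneStep
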